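import Literature.NumberTheory.LFunctions.LittlewoodLemma
import Literature.Analysis.Complex.LevinsonConreyZeroDetection
import HarnessLib

/-!
# The `Γℝ` factor in Levinson's method: `Δ arg Γℝ(½+it) = Δθ = π ΔN + O(log T)`, and zero detection for `Q = Γℝ · V`

Topic `Literature/NumberTheory/LFunctions`. Proofs only. In Conrey's arrangement of Levinson's
method (J. B. Conrey, *J. Number Theory* 16 (1983), §4, (2): "It follows from Lemmas 1 (part (a))
and 2 that `(1/π)(arg H(½ + i(T+U)) − arg H(½ + iT)) = N(T+U) − N(T) + O(log T)`") the auxiliary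
function is `Q = H · V` with `H` the archimedean factor of `ξ`. We take `H = Γℝ`
(`Γℝ(s) = π^{-s/2} Γ(s/2)`, Mathlib `Complex.Gammaℝ`), for which the tree *defines* the Riemann–Siegel
theta function by `θ(T) = ∫₀ᵀ Re (Γℝ'/Γℝ)(½ + iu) du`
(`Literature.NumberTheory.LFunctions.riemannSiegelTheta`, `Literature.NumberTheory.LFunctions.logDeriv_Gammaℝ_half_add_re`) and
`S(T)` by `N(T) = θ(T)/π + 1 + S(T)` (`Literature.NumberTheory.LFunctions.zetaZeroCount_eq_theta_add_zetaArgS`), with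
`S(T) = O(log T)` proved (`Literature.NumberTheory.LFunctions.abs_zetaArgS_le`). Hence:

* `integral_re_logDeriv_Gammaℝ_half` — `∫_{T₁}^{T₂} Re (Γℝ'/Γℝ)(½+it) dt = θ(T₂) − θ(T₁)`;
* `threeEdge_logDeriv_Gammaℝ_eq` — the same for the three-edge boundary terms of `Γℝ'/Γℝ` on
  `[½, b] × [T₁, T₂]` (`Γℝ` is analytic and zero-free on `Re s > 0`; the tree's
  `Literature.Analysis.Complex.integral_re_logDeriv_left_add_finsum_eq`);
* `zetaZeroCount_sub_eq` — `N(T₂) − N(T₁) = (θ(T₂) − θ(T₁))/π + S(T₂) − S(T₁)`;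
* `levinsonConrey_zeroDetection_Gammaℝ_mul` — **Conrey's (2)–(3)**: for `V` analytic on
  `R = [½, b] × [T₁, T₂]`, non-zero on its bottom, top and right edges, and `Q = Γℝ · V`, the zeros
  of `Q + Q♯` (`Q♯(s) = conj Q(1 − s̄)`) on the open critical segment, with multiplicity, number at
  least `N(T₂) − N(T₁) − (S(T₂) − S(T₁)) + (1/π)(three-edge terms of V'/V) − 2 N_V − 1`, `N_V` the
  number of zeros of `V` inside `R` (generic part:
  `Literature.Analysis.Complex.levinsonConrey_zeroDetection`).

With `K ξ = Q + Q♯` (the choice of `V` of Conrey §4, (1)) the left side is `N₀(T₂) − N₀(T₁)`; the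
three-edge terms of `V'/V` are `O(log T)` by Jensen/Backlund on the horizontal edges and `O(1)` on
the right edge, which is (3).

## References

* J. B. Conrey, *Zeros of derivatives of Riemann's ξ-function on the critical line*, J. Number
  Theory 16 (1983), 49–74, §4 (2)–(3). [Conrey1983]
* E. C. Titchmarsh, *The Theory of the Riemann Zeta-Function*, 2nd ed. (1986), §9.3 (`N(T)` and
  `θ`), §10.28.
-/

noncomputable section

open Complex Set MeasureTheory Filter Topology intervalIntegral
open scoped Real ComplexConjugate

namespace Literature.NumberTheory.LFunctions

open Literature.Analysis.Complex

/-! ## `Γℝ` along the critical line and around `[½, b] × [T₁, T₂]` -/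

/-- **`∫_{T₁}^{T₂} Re (Γℝ'/Γℝ)(½ + it) dt = θ(T₂) − θ(T₁)`** (the tree defines `θ` as the primitive
of `θ'(t) = Re (Γℝ'/Γℝ)(½ + it)`). [cite: Titchmarsh1986, §9.3] -/
theorem integral_re_logDeriv_Gammaℝ_half (T₁ T₂ : ℝ) :
    ∫ y in T₁..T₂, (deriv Gammaℝ (((1 / 2 : ℝ) : ℂ) + y * I) / Gammaℝ (((1 / 2 : ℝ) : ℂ) + y * I)).re =
      riemannSiegelTheta T₂ - riemannSiegelTheta T₁ := by
  have hderiv : ∀ y : ℝ, (deriv Gammaℝ (((1 / 2 : ℝ) : ℂ) + y * I) / Gammaℝ (((1 / 2 : ℝ) : ℂ) + y * I)).re =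
      riemannSiegelThetaDeriv y := fun y ↦ by
    rw [← logDeriv_apply, logDeriv_Gammaℝ_half_add_re]
  simp_rw [hderiv]
  exact intervalIntegral.integral_eq_sub_of_hasDerivAt (fun t _ ↦ hasDerivAt_riemannSiegelTheta_holds t)
    (continuous_riemannSiegelThetaDeriv_holds.intervalIntegrable _ _)

/-- `Γℝ` is analytic at every point of the closed rectangle `[½, b] × [T₁, T₂]`. [folklore] -/
theorem analyticOnNhd_Gammaℝ_rect (b T₁ T₂ : ℝ) :
    AnalyticOnNhd ℂ Gammaℝ (Icc (1 / 2 : ℝ) b ×ℂ Icc T₁ T₂) := fun _ hs ↦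
  analyticAt_Gammaℝ_of_re_pos (lt_of_lt_of_le one_half_pos (Complex.mem_reProdIm.1 hs).1.1)

/-- **The three-edge boundary terms of `Γℝ'/Γℝ` on `[½, b] × [T₁, T₂]` equal `θ(T₂) − θ(T₁)`**
(`Γℝ` is analytic and zero-free on `Re s > 0`, so the argument principle with no zeros reduces them
to the left-edge integral). [cite: Titchmarsh1986, §9.3] -/
theorem threeEdge_logDeriv_Gammaℝ_eq {b T₁ T₂ : ℝ} (hb : (1 / 2 : ℝ) < b) (hT : T₁ < T₂) :
    (∫ x in (1 / 2 : ℝ)..b, deriv Gammaℝ (x + T₁ * I) / Gammaℝ (x + T₁ * I)).im -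
        (∫ x in (1 / 2 : ℝ)..b, deriv Gammaℝ (x + T₂ * I) / Gammaℝ (x + T₂ * I)).im +
        (∫ y in T₁..T₂, (deriv Gammaℝ (b + y * I) / Gammaℝ (b + y * I)).re) =
      riemannSiegelTheta T₂ - riemannSiegelTheta T₁ := by
  have hf := analyticOnNhd_Gammaℝ_rect b T₁ T₂
  have hne : ∀ z ∈ Icc (1 / 2 : ℝ) b ×ℂ Icc T₁ T₂, Gammaℝ z ≠ 0 := fun z hz ↦
    Gammaℝ_ne_zero_of_re_pos (lt_of_lt_of_le one_half_pos (Complex.mem_reProdIm.1 hz).1.1)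
  have h_bot : ∀ x ∈ Icc (1 / 2 : ℝ) b, Gammaℝ (x + T₁ * I) ≠ 0 := fun x hx ↦
    hne _ ⟨by simpa using hx, by simpa using hT.le⟩
  have h_top : ∀ x ∈ Icc (1 / 2 : ℝ) b, Gammaℝ (x + T₂ * I) ≠ 0 := fun x hx ↦
    hne _ ⟨by simpa using hx, by simpa using hT.le⟩
  have h_right : ∀ y ∈ Icc T₁ T₂, Gammaℝ (b + y * I) ≠ 0 := fun y hy ↦
    hne _ ⟨by simpa using hb.le, by simpa using hy⟩
  have h := integral_re_logDeriv_left_add_finsum_eq hb hT hf h_bot h_top h_right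
  have hleft : {t : ℝ | Gammaℝ (((1 / 2 : ℝ) : ℂ) + t * I) = 0 ∧ t ∈ Ioo T₁ T₂} = ∅ := by
    ext t
    simp only [mem_setOf_eq, mem_empty_iff_false, iff_false, not_and]
    intro h0
    exact absurd h0 (Gammaℝ_ne_zero_of_re_pos (by simp))
  have hint : {ρ : ℂ | Gammaℝ ρ = 0 ∧ ρ ∈ Ioo (1 / 2 : ℝ) b ×ℂ Ioo T₁ T₂} = ∅ := by
    ext ρ
    simp only [mem_setOf_eq, mem_empty_iff_false, iff_false, not_and]
    intro h0 hρ
    exact Gammaℝ_ne_zero_of_re_pos (lt_trans one_half_pos (Complex.mem_reProdIm.1 hρ).1.1) h0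
  rw [hleft, hint, finsum_mem_empty, finsum_mem_empty, mul_zero, add_zero, mul_zero, sub_zero,
    integral_re_logDeriv_Gammaℝ_half] at h
  linarith

/-- **`N(T₂) − N(T₁) = (θ(T₂) − θ(T₁))/π + S(T₂) − S(T₁)`** (the tree's definition of `S`).
[cite: Titchmarsh1986, §9.3] -/
theorem zetaZeroCount_sub_eq (T₁ T₂ : ℝ) :
    (zetaZeroCount T₂ : ℝ) - zetaZeroCount T₁ =
      (riemannSiegelTheta T₂ - riemannSiegelTheta T₁) / π + (zetaArgS T₂ - zetaArgS T₁) := by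
  rw [zetaZeroCount_eq_theta_add_zetaArgS, zetaZeroCount_eq_theta_add_zetaArgS]
  ring

/-! ## Zero detection for `Q = Γℝ · V` -/

/-- Logarithmic derivative of `Γℝ · V`: `(Γℝ V)'/(Γℝ V) = Γℝ'/Γℝ + V'/V` where `V` is analytic and
non-zero and `Re s > 0`. [folklore] -/
theorem logDeriv_Gammaℝ_mul {V : ℂ → ℂ} {s : ℂ} (hs : 0 < s.re) (hV : AnalyticAt ℂ V s)
    (hV0 : V s ≠ 0) :
    deriv (fun z ↦ Gammaℝ z * V z) s / (Gammaℝ s * V s) =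
      deriv Gammaℝ s / Gammaℝ s + deriv V s / V s := by
  have h := logDeriv_mul s (Gammaℝ_ne_zero_of_re_pos hs) hV0
    (analyticAt_Gammaℝ_of_re_pos hs).differentiableAt hV.differentiableAt
  simp only [logDeriv_apply] at h
  exact h

/-- **Conrey's (2)–(3), generic in `V`.** Let `V` be analytic at every point of
`R = [½, b] × [T₁, T₂]` (`½ < b`, `T₁ < T₂`), non-zero on the bottom, top and right edges of `R`,
put `Q = Γℝ · V` and `Q♯(s) = conj Q(1 − s̄)`, and assume `Q + Q♯` has finite order at each point
of the open critical segment `{½} × (T₁, T₂)`. Then the zeros of `Q + Q♯` on that segment, with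
multiplicity, number at least
`N(T₂) − N(T₁) − (S(T₂) − S(T₁)) + (1/π)(Im ∫_{½}^{b} (V'/V)(x+iT₁) dx − Im ∫_{½}^{b} (V'/V)(x+iT₂) dx`
`  + ∫_{T₁}^{T₂} Re (V'/V)(b+it) dt) − 2 N_V − 1`,
`N_V = Σ_{ρ ∈ R°, V(ρ)=0} m(ρ)`. [cite: Conrey1983, §4 (2)–(3)] -/
theorem levinsonConrey_zeroDetection_Gammaℝ_mul {V : ℂ → ℂ} {b T₁ T₂ : ℝ} (hb : (1 / 2 : ℝ) < b)
    (hT : T₁ < T₂) (hV : AnalyticOnNhd ℂ V (Icc (1 / 2 : ℝ) b ×ℂ Icc T₁ T₂))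
    (h_bot : ∀ x ∈ Icc (1 / 2 : ℝ) b, V (x + T₁ * I) ≠ 0) (h_top : ∀ x ∈ Icc (1 / 2 : ℝ) b, V (x + T₂ * I) ≠ 0)
    (h_right : ∀ y ∈ Icc T₁ T₂, V (b + y * I) ≠ 0)
    (hfin : ∀ t ∈ Ioo T₁ T₂, analyticOrderAt
      (fun s : ℂ ↦ Gammaℝ s * V s + conj (Gammaℝ ((2 * (1 / 2 : ℝ) : ℂ) - conj s) *
        V ((2 * (1 / 2 : ℝ) : ℂ) - conj s))) (((1 / 2 : ℝ) : ℂ) + t * I) ≠ ⊤) :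
    ∃ Z : Finset ℝ, (↑Z : Set ℝ) ⊆ Ioo T₁ T₂ ∧
      (∀ t ∈ Z, Gammaℝ (((1 / 2 : ℝ) : ℂ) + t * I) * V (((1 / 2 : ℝ) : ℂ) + t * I) +
        conj (Gammaℝ ((2 * (1 / 2 : ℝ) : ℂ) - conj (((1 / 2 : ℝ) : ℂ) + t * I)) *
          V ((2 * (1 / 2 : ℝ) : ℂ) - conj (((1 / 2 : ℝ) : ℂ) + t * I))) = 0) ∧
      ((zetaZeroCount T₂ : ℝ) - zetaZeroCount T₁) - (zetaArgS T₂ - zetaArgS T₁) +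
        ((∫ x in (1 / 2 : ℝ)..b, deriv V (x + T₁ * I) / V (x + T₁ * I)).im -
          (∫ x in (1 / 2 : ℝ)..b, deriv V (x + T₂ * I) / V (x + T₂ * I)).im +
          (∫ y in T₁..T₂, (deriv V (b + y * I) / V (b + y * I)).re)) / π -
        2 * ∑ᶠ ρ ∈ {ρ : ℂ | V ρ = 0 ∧ ρ ∈ Ioo (1 / 2 : ℝ) b ×ℂ Ioo T₁ T₂},
          ((meromorphicOrderAt V ρ).untop₀ : ℝ) - 1 ≤
        ∑ t ∈ Z, ((analyticOrderAt
          (fun s : ℂ ↦ Gammaℝ s * V s + conj (Gammaℝ ((2 * (1 / 2 : ℝ) : ℂ) - conj s) *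
            V ((2 * (1 / 2 : ℝ) : ℂ) - conj s))) (((1 / 2 : ℝ) : ℂ) + t * I)).toNat : ℝ) := by
  set Q : ℂ → ℂ := fun s ↦ Gammaℝ s * V s with hQ_def
  -- hypotheses of the generic theorem for `Q`
  have hre : ∀ z ∈ Icc (1 / 2 : ℝ) b ×ℂ Icc T₁ T₂, 0 < z.re := fun z hz ↦
    lt_of_lt_of_le one_half_pos (Complex.mem_reProdIm.1 hz).1.1
  have hG := analyticOnNhd_Gammaℝ_rect b T₁ T₂
  have hQ : AnalyticOnNhd ℂ Q (Icc (1 / 2 : ℝ) b ×ℂ Icc T₁ T₂) := fun z hz ↦ (hG z hz).mul (hV z hz)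
  have hGne : ∀ z ∈ Icc (1 / 2 : ℝ) b ×ℂ Icc T₁ T₂, Gammaℝ z ≠ 0 := fun z hz ↦
    Gammaℝ_ne_zero_of_re_pos (hre z hz)
  have hbot_mem : ∀ x ∈ Icc (1 / 2 : ℝ) b, ((x : ℂ) + T₁ * I) ∈ Icc (1 / 2 : ℝ) b ×ℂ Icc T₁ T₂ :=
    fun x hx ↦ ⟨by simpa using hx, by simpa using hT.le⟩
  have htop_mem : ∀ x ∈ Icc (1 / 2 : ℝ) b, ((x : ℂ) + T₂ * I) ∈ Icc (1 / 2 : ℝ) b ×ℂ Icc T₁ T₂ :=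
    fun x hx ↦ ⟨by simpa using hx, by simpa using hT.le⟩
  have hright_mem : ∀ y ∈ Icc T₁ T₂, ((b : ℂ) + y * I) ∈ Icc (1 / 2 : ℝ) b ×ℂ Icc T₁ T₂ :=
    fun y hy ↦ ⟨by simpa using hb.le, by simpa using hy⟩
  have hQ_bot : ∀ x ∈ Icc (1 / 2 : ℝ) b, Q (x + T₁ * I) ≠ 0 := fun x hx ↦
    mul_ne_zero (hGne _ (hbot_mem x hx)) (h_bot x hx)
  have hQ_top : ∀ x ∈ Icc (1 / 2 : ℝ) b, Q (x + T₂ * I) ≠ 0 := fun x hx ↦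
    mul_ne_zero (hGne _ (htop_mem x hx)) (h_top x hx)
  have hQ_right : ∀ y ∈ Icc T₁ T₂, Q (b + y * I) ≠ 0 := fun y hy ↦
    mul_ne_zero (hGne _ (hright_mem y hy)) (h_right y hy)
  obtain ⟨Z, hZsub, hZ0, hcnt⟩ :=
    levinsonConrey_zeroDetection hb hT hQ hQ_bot hQ_top hQ_right hfin
  refine ⟨Z, hZsub, hZ0, le_trans (le_of_eq ?_) hcnt⟩
  -- (1) the three-edge terms of `Q'/Q` split as those of `Γℝ'/Γℝ` plus those of `V'/V`
  have hsplit : ∀ z ∈ Icc (1 / 2 : ℝ) b ×ℂ Icc T₁ T₂, V z ≠ 0 →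
      deriv Q z / Q z = deriv Gammaℝ z / Gammaℝ z + deriv V z / V z := fun z hz hVz ↦
    logDeriv_Gammaℝ_mul (hre z hz) (hV z hz) hVz
  have hcontG_h : ∀ y₀ : ℝ, ContinuousOn (fun x : ℝ ↦ deriv Gammaℝ (x + y₀ * I) / Gammaℝ (x + y₀ * I))
      (Icc (1 / 2 : ℝ) b) := fun y₀ ↦
    continuousOn_logDeriv_horizontal (fun x hx ↦ analyticAt_Gammaℝ_of_re_pos (by simp; linarith [hx.1]))
      (fun x hx ↦ Gammaℝ_ne_zero_of_re_pos (by simp; linarith [hx.1]))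
  have hcontV_bot : ContinuousOn (fun x : ℝ ↦ deriv V (x + T₁ * I) / V (x + T₁ * I)) (Icc (1 / 2 : ℝ) b) :=
    continuousOn_logDeriv_horizontal (fun x hx ↦ hV _ (hbot_mem x hx)) h_bot
  have hcontV_top : ContinuousOn (fun x : ℝ ↦ deriv V (x + T₂ * I) / V (x + T₂ * I)) (Icc (1 / 2 : ℝ) b) :=
    continuousOn_logDeriv_horizontal (fun x hx ↦ hV _ (htop_mem x hx)) h_top
  have hcontG_v : ContinuousOn (fun y : ℝ ↦ deriv Gammaℝ (b + y * I) / Gammaℝ (b + y * I)) (Icc T₁ T₂) :=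
    continuousOn_logDeriv_vertical (fun y hy ↦ analyticAt_Gammaℝ_of_re_pos (by simp; linarith))
      (fun y hy ↦ Gammaℝ_ne_zero_of_re_pos (by simp; linarith))
  have hcontV_v : ContinuousOn (fun y : ℝ ↦ deriv V (b + y * I) / V (b + y * I)) (Icc T₁ T₂) :=
    continuousOn_logDeriv_vertical (fun y hy ↦ hV _ (hright_mem y hy)) h_right
  have e_bot : (∫ x in (1 / 2 : ℝ)..b, deriv Q (x + T₁ * I) / Q (x + T₁ * I)) =
      (∫ x in (1 / 2 : ℝ)..b, deriv Gammaℝ (x + T₁ * I) / Gammaℝ (x + T₁ * I)) +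
        ∫ x in (1 / 2 : ℝ)..b, deriv V (x + T₁ * I) / V (x + T₁ * I) := by
    rw [← intervalIntegral.integral_add ((hcontG_h T₁).intervalIntegrable_of_Icc hb.le)
      (hcontV_bot.intervalIntegrable_of_Icc hb.le)]
    refine intervalIntegral.integral_congr fun x hx ↦ ?_
    rw [uIcc_of_le hb.le] at hx
    exact hsplit _ (hbot_mem x hx) (h_bot x hx)
  have e_top : (∫ x in (1 / 2 : ℝ)..b, deriv Q (x + T₂ * I) / Q (x + T₂ * I)) =
      (∫ x in (1 / 2 : ℝ)..b, deriv Gammaℝ (x + T₂ * I) / Gammaℝ (x + T₂ * I)) +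
        ∫ x in (1 / 2 : ℝ)..b, deriv V (x + T₂ * I) / V (x + T₂ * I) := by
    rw [← intervalIntegral.integral_add ((hcontG_h T₂).intervalIntegrable_of_Icc hb.le)
      (hcontV_top.intervalIntegrable_of_Icc hb.le)]
    refine intervalIntegral.integral_congr fun x hx ↦ ?_
    rw [uIcc_of_le hb.le] at hx
    exact hsplit _ (htop_mem x hx) (h_top x hx)
  have e_right : (∫ y in T₁..T₂, (deriv Q (b + y * I) / Q (b + y * I)).re) =
      (∫ y in T₁..T₂, (deriv Gammaℝ (b + y * I) / Gammaℝ (b + y * I)).re) +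
        ∫ y in T₁..T₂, (deriv V (b + y * I) / V (b + y * I)).re := by
    have i1 : IntervalIntegrable (fun y : ℝ ↦ (deriv Gammaℝ (b + y * I) / Gammaℝ (b + y * I)).re)
        volume T₁ T₂ := (continuous_re.comp_continuousOn hcontG_v).intervalIntegrable_of_Icc hT.le
    have i2 : IntervalIntegrable (fun y : ℝ ↦ (deriv V (b + y * I) / V (b + y * I)).re)
        volume T₁ T₂ := (continuous_re.comp_continuousOn hcontV_v).intervalIntegrable_of_Icc hT.le
    rw [← intervalIntegral.integral_add i1 i2]
    refine intervalIntegral.integral_congr fun y hy ↦ ?_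
    rw [uIcc_of_le hT.le] at hy
    show (deriv Q (b + y * I) / Q (b + y * I)).re = _
    rw [hsplit _ (hright_mem y hy) (h_right y hy), add_re]
  -- (2) the interior zeros of `Q` are those of `V`, with the same orders
  have e_int : ∑ᶠ ρ ∈ {ρ : ℂ | Q ρ = 0 ∧ ρ ∈ Ioo (1 / 2 : ℝ) b ×ℂ Ioo T₁ T₂}, ((meromorphicOrderAt Q ρ).untop₀ : ℝ) =
      ∑ᶠ ρ ∈ {ρ : ℂ | V ρ = 0 ∧ ρ ∈ Ioo (1 / 2 : ℝ) b ×ℂ Ioo T₁ T₂}, ((meromorphicOrderAt V ρ).untop₀ : ℝ) := by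
    have hK : ∀ ρ, ρ ∈ Ioo (1 / 2 : ℝ) b ×ℂ Ioo T₁ T₂ → ρ ∈ Icc (1 / 2 : ℝ) b ×ℂ Icc T₁ T₂ := fun ρ hρ ↦
      ⟨Ioo_subset_Icc_self hρ.1, Ioo_subset_Icc_self hρ.2⟩
    have hset : {ρ : ℂ | Q ρ = 0 ∧ ρ ∈ Ioo (1 / 2 : ℝ) b ×ℂ Ioo T₁ T₂} =
        {ρ : ℂ | V ρ = 0 ∧ ρ ∈ Ioo (1 / 2 : ℝ) b ×ℂ Ioo T₁ T₂} := by
      ext ρ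
      simp only [mem_setOf_eq, hQ_def]
      constructor
      · rintro ⟨h0, hρ⟩
        exact ⟨(mul_eq_zero.1 h0).resolve_left (hGne ρ (hK ρ hρ)), hρ⟩
      · rintro ⟨h0, hρ⟩
        exact ⟨by rw [h0, mul_zero], hρ⟩
    refine finsum_mem_congr hset fun ρ hρ ↦ ?_
    have hρK := hK ρ hρ.2
    have h1 : meromorphicOrderAt Q ρ = meromorphicOrderAt Gammaℝ ρ + meromorphicOrderAt V ρ :=
      meromorphicOrderAt_mul (hG ρ hρK).meromorphicAt (hV ρ hρK).meromorphicAt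
    have h2 : meromorphicOrderAt Gammaℝ ρ = 0 := by
      rw [(hG ρ hρK).meromorphicOrderAt_eq, (hG ρ hρK).analyticOrderAt_eq_zero.2 (hGne ρ hρK)]
      simp
    rw [h1, h2, zero_add]
  -- (3) assemble with `θ` and `S`
  have hθ := threeEdge_logDeriv_Gammaℝ_eq hb hT
  have hN := zetaZeroCount_sub_eq T₁ T₂
  rw [e_bot, e_top, e_right, e_int, add_im, add_im, hN, ← hθ]
  ring

end Literature.NumberTheory.LFunctions

end
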